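import Literature.MathematicalPhysics.QuantumLattice.LatticeGaugeDLR
import HarnessLib

/-!
# Class-B states: the axiomatic infinite-volume RP states of the lattice bootstrap (gauge-boot, L3(α))

HONEST FRAMING (cell `pub-gaugeboot`, page 1 of every file): the venture produces certified bounds
on lattice expectations at stated coupling, gauge group, dimension and torus size; NOT a mass gap,
NOT a continuum limit, NOT a string tension; NOT Yang–Mills-summit-bearing (barriers
`FixedCouplingUltralocality`, `PerturbativeInvisibility`). This module is an INTERFACE (definitions
and two elementary lemmas). It asserts nothing about lattice Yang–Mills: in particular it does NOT
claim that any thermodynamic-limit state is a Class-B state — that identification is the separate,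
OPEN statement `ThermodynamicLimitIsClassB` below, known only in the Osterwalder–Seiler
strong-coupling regime and never used as a hypothesis-free fact by the cell.

## Why (SCOPING.md A9/A18, LOOP-SDP.md §3.4, `DiagonalRPTorusNegative.lean`)

A loop-equation SDP certificate is a proof of `a ≤ ω(u_P) ≤ b` for every assignment `ω` of loop
expectation values satisfying the finitely many constraints fed to the solver: loop (Schwinger–Dyson)
equations, symmetry identifications, Gram positivity and reflection positivities. The cell's
statement of record (Class A) reads the constraints off the TORUS Wilson states, where Gram, site-RP
and link-RP blocks are theorems but DIAGONAL-RP blocks are not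
(`Summit.QuantumFields.GaugeBoot.not_diagonalReflectionPositive`). Certificates that use diagonal
blocks (Kazakov–Zheng's third family, Guo–Li–Yang–Zhu's `R₂`) are still sound — for a DIFFERENT,
explicitly labelled object: the class of translation- and hyperoctahedrally-invariant states of
the infinite lattice `ℤ^d` that obey the one-link Gibbs (Haar-shift) identity of the Wilson action
and all three RP families. This file fixes that class over the tree's `ℤ^d` vocabulary
(`Literature.MathematicalPhysics.QuantumLattice.{LGConfig, ZdEdge, configShift,
IsZdTranslationInvariant, IsCylinder, wilsonBoundaryAction, infiniteVolumeLimitPoints}`):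

* reflections of `ℤ^d` and the induced involutions of configurations `LGConfig d G = ZdEdge d → G`:
  `zdSiteReflect i` / `configSiteReflect i` (mirror `x_i = 0`, direction-`i` links inverted),
  `zdLinkReflect i` / `configLinkReflect i` (mirror `x_i = ½`), `zdDiagSwap i j` /
  `configDiagSwapZd i j` (mirror `x_i = x_j`, no inversion), `configPerm σ` (axis permutations);
* the closed half-spaces as EDGE sets: `siteHalfEdges i = {x_i ≥ 0}`, `linkHalfEdges i = {x_i ≥ 1}`,
  `diagHalfEdges i j = {x_i ≥ x_j}` (both endpoints in the half);
* `IsReflectionPositiveFor Θ S μ` — `0 ≤ ∫ (F∘Θ)‾ F dμ` for bounded measurable `F` with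
  `DependsOn F S` (the shape of the tree's `wilsonExpectation_reflectionPositive`);
* `IsHaarShiftState ρ β μ` — the one-link Gibbs identity
  `∫ f(U[e ↦ g U_e]) dμ = ∫ f(U) exp(-β (S_e(U[e ↦ g⁻¹ U_e]) - S_e(U))) dμ` for continuous cylinder
  `f`, `S_e = wilsonBoundaryAction ρ {e}` the action of the `2(d-1)` plaquettes containing `e` (the
  `ℤ^d` form of the torus theorem `haarShift_wilsonExpectation`; its derivative along one-parameter
  subgroups is the single-link Schwinger–Dyson identity from which the loop equations of task L1 are
  read off);
* **`structure ClassBState ρ β`** — a probability measure on `LGConfig d G` with: translation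
  invariance, axis-permutation and axis-reflection invariance (together: the affine hyperoctahedral
  group `ℤ^d ⋊ B_d`), the Haar-shift identity, and site-, link- and diagonal-RP;
* `IsReflectionPositiveFor.sum_mul_conj_nonneg` — the RP AXIOM ⇒ every finite RP block
  `(∫ (F_a∘Θ)‾ F_b dμ)_{ab}` is positive semidefinite (the step that turns a Class-B axiom into an
  SDP block); `gram_sum_mul_conj_nonneg` — Gram blocks are PSD for every measure;
* `ThermodynamicLimitIsClassB ρ β` (OPEN, a `Prop`, never asserted): every infinite-volume limit
  point of torus Wilson states (`infiniteVolumeLimitPoints ρ β`) underlies a Class-B state; and its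
  load-bearing open conjunct `TorusLimitPointsDiagonalRP ρ β`.

## What is NOT here / status of the identification

Translation and hyperoctahedral invariance, the Haar-shift identity, site-RP and link-RP DO pass
from the torus states (tree theorems `wilsonExpectation_comp_torusConfigShift`,
`haarShift_wilsonExpectation`, `wilsonExpectation_reflectionPositive_holds`,
`wilsonExpectation_siteReflectionPositive`) to their weak limits by routine arguments that are NOT
carried out in this file. Diagonal RP does NOT hold on the torus (`DiagonalRPTorusNegative.lean`);
it holds for free symmetric boxes (Kazakov–Zheng arXiv:2404.16925 p. 10; task L3(β)), whose limit
points are in turn not known to be translation invariant. Hence `ThermodynamicLimitIsClassB` is a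
theorem only where the infinite-volume state is unique (Osterwalder–Seiler, Ann. Phys. 110 (1978)
§4, strong coupling) and is OPEN otherwise; every Class-B certificate row of the cell is labelled
"Class B (axiomatic RP state; identification with torus limits open at this β)" (SCOPING A18).
The Wilson-loop functional `W_ω(C)`: `ClassBWords.lean`; "Haar-shift ⇒ loop equations" for every Class-B
state (UPDATE 2026-08-28): `ZdLoopEquationStates.lean`, `ClassBState.loopEquation_pairForm_suN` / `_uN`.

References: V. Kazakov, Z. Zheng, arXiv:2203.11360 §3.1; arXiv:2404.16925 §3.2, p. 10 (RP families,
infinite-volume setting of the bootstrap); Y. Guo, Z. Li, G. Yang, G. Zhu, arXiv:2502.14421 §2.2, p. 16;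
K. Osterwalder, E. Seiler, Ann. Phys. 110 (1978) 440 §§2–4; E. Seiler, LNP 159 (1982) Ch. 2;
H.-O. Georgii, Gibbs Measures and Phase Transitions (2011) Def. 2.9 (DLR ⇔ local kernels).
-/

noncomputable section

open MeasureTheory Complex
open scoped ComplexOrder
open Literature.Probability.LatticeModels (Site)
open Literature.MathematicalPhysics.QuantumLattice

namespace Summit.QuantumFields.GaugeBoot

variable {d N : ℕ} {G : Type*}

/-! ## Reflections and axis permutations of `ℤ^d` and of its gauge configurations -/

section Maps

/-- Site reflection in the hyperplane `x_i = 0`: `x_i ↦ -x_i` (Kazakov–Zheng's first RP family;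
GLYZ's mirror `x = 0`). [shape] A definition, asserting nothing. [folklore] -/
def zdSiteReflect (i : Fin d) (x : Site d) : Site d := Function.update x i (-x i)

/-- Link reflection in the hyperplane `x_i = ½`: `x_i ↦ 1 - x_i` (second RP family;
Osterwalder–Seiler's reflection between sites). [folklore] -/
def zdLinkReflect (i : Fin d) (x : Site d) : Site d := Function.update x i (1 - x i)

/-- Diagonal reflection in the hyperplane `x_i = x_j`: the coordinates `i, j` are exchanged
(third RP family; GLYZ's mirror `x = z`). [folklore] -/
def zdDiagSwap (i j : Fin d) (x : Site d) : Site d := fun k => x (Equiv.swap i j k)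

variable [Group G]

/-- The involution of configurations induced by the site reflection `θ = zdSiteReflect i`:
links in direction `k ≠ i` are carried along, `(ΘU)(x,k) = U(θx, k)`; the link `x → x + e_i` is
mapped onto the REVERSED link `θx → θx - e_i`, whence `(ΘU)(x,i) = U(θx - e_i, i)⁻¹` (the tree's
convention `GaugeConfig.timeReflect`, `QCDTimeReflection.cfgReflect`). [folklore] -/
def configSiteReflect (i : Fin d) (U : LGConfig d G) : LGConfig d G := fun e =>
  if e.2 = i then (U (zdSiteReflect i e.1 - Pi.single i 1, i))⁻¹ else U (zdSiteReflect i e.1, e.2)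

/-- The involution of configurations induced by the link reflection `θ = zdLinkReflect i`
(same orientation rule as `configSiteReflect`). [folklore] -/
def configLinkReflect (i : Fin d) (U : LGConfig d G) : LGConfig d G := fun e =>
  if e.2 = i then (U (zdLinkReflect i e.1 - Pi.single i 1, i))⁻¹ else U (zdLinkReflect i e.1, e.2)

/-- The involution of configurations induced by the diagonal swap `θ = zdDiagSwap i j`: the link
`x → x + e_k` goes to the positively oriented link `θx → θx + e_{(i j) k}`; no inversion.
[folklore] -/
def configDiagSwapZd (i j : Fin d) (U : LGConfig d G) : LGConfig d G := fun e =>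
  U (zdDiagSwap i j e.1, Equiv.swap i j e.2)

/-- The map of configurations induced by the axis permutation `x ↦ x ∘ σ`: the link `x → x + e_k`
goes to `x∘σ → x∘σ + e_{σ⁻¹ k}`. Together with the axis reflections these generate the
hyperoctahedral group `B_d`. [folklore] -/
def configPerm (σ : Equiv.Perm (Fin d)) (U : LGConfig d G) : LGConfig d G := fun e =>
  U (e.1 ∘ σ, σ.symm e.2)

/-- `θ` (site) is an involution. -/
@[simp] theorem zdSiteReflect_zdSiteReflect (i : Fin d) (x : Site d) :
    zdSiteReflect i (zdSiteReflect i x) = x := by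
  ext k; by_cases hk : k = i <;> simp [zdSiteReflect, hk]

/-- `θ` (link) is an involution. -/
@[simp] theorem zdLinkReflect_zdLinkReflect (i : Fin d) (x : Site d) :
    zdLinkReflect i (zdLinkReflect i x) = x := by
  ext k; by_cases hk : k = i <;> simp [zdLinkReflect, hk]

/-- `θ` (diagonal) is an involution. -/
@[simp] theorem zdDiagSwap_zdDiagSwap (i j : Fin d) (x : Site d) :
    zdDiagSwap i j (zdDiagSwap i j x) = x := by
  ext k; simp [zdDiagSwap, Equiv.swap_apply_self]

/-- `θ(y - e_i) = θy + e_i` for the site reflection (it negates the `i`-th coordinate). -/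
theorem zdSiteReflect_sub_single (i : Fin d) (y : Site d) :
    zdSiteReflect i (y - Pi.single i 1) = zdSiteReflect i y + Pi.single i 1 := by
  ext k; by_cases hk : k = i
  · subst hk; simp [zdSiteReflect]; ring
  · simp [zdSiteReflect, hk]

/-- `θ(y - e_i) = θy + e_i` for the link reflection. -/
theorem zdLinkReflect_sub_single (i : Fin d) (y : Site d) :
    zdLinkReflect i (y - Pi.single i 1) = zdLinkReflect i y + Pi.single i 1 := by
  ext k; by_cases hk : k = i
  · subst hk; simp [zdLinkReflect]; ring
  · simp [zdLinkReflect, hk]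

/-- `Θ` (site) is an involution on configurations — the orientation bookkeeping of
`configSiteReflect` is consistent. -/
theorem configSiteReflect_configSiteReflect (i : Fin d) (U : LGConfig d G) :
    configSiteReflect i (configSiteReflect i U) = U := by
  funext ⟨x, k⟩
  by_cases hk : k = i
  · subst hk
    simp [configSiteReflect, zdSiteReflect_sub_single]
  · simp [configSiteReflect, hk]

/-- `Θ` (link) is an involution on configurations. -/
theorem configLinkReflect_configLinkReflect (i : Fin d) (U : LGConfig d G) :
    configLinkReflect i (configLinkReflect i U) = U := by
  funext ⟨x, k⟩
  by_cases hk : k = i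
  · subst hk
    simp [configLinkReflect, zdLinkReflect_sub_single]
  · simp [configLinkReflect, hk]

omit [Group G] in
/-- `Θ` (diagonal) is an involution on configurations. -/
theorem configDiagSwapZd_configDiagSwapZd (i j : Fin d) (U : LGConfig d G) :
    configDiagSwapZd i j (configDiagSwapZd i j U) = U := by
  funext ⟨x, k⟩
  simp [configDiagSwapZd, Equiv.swap_apply_self]

end Maps

/-! ## Closed half-spaces as edge sets -/

section Halves

/-- Links with both endpoints in the closed half `{x_i ≥ 0}` of the site mirror `x_i = 0`
(a link `(x, k)` runs from `x` to `x + e_k`, so the condition is `x_i ≥ 0`). [folklore] -/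
def siteHalfEdges (i : Fin d) : Set (ZdEdge d) := {e | 0 ≤ e.1 i}

/-- Links with both endpoints in the closed half `{x_i ≥ 1}` of the link mirror `x_i = ½`.
[folklore] -/
def linkHalfEdges (i : Fin d) : Set (ZdEdge d) := {e | 1 ≤ e.1 i}

/-- Links with both endpoints in the closed half `{x_i ≥ x_j}` of the diagonal mirror `x_i = x_j`
(a link in direction `j` needs `x_i ≥ x_j + 1` at its source). [folklore] -/
def diagHalfEdges (i j : Fin d) : Set (ZdEdge d) := {e | e.1 j ≤ e.1 i ∧ (e.2 = j → e.1 j + 1 ≤ e.1 i)}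

end Halves

/-! ## Reflection positivity and the Haar-shift (one-link Gibbs) identity as properties of a state -/

section Axioms

variable [Group G] [MeasurableSpace G]

/-- `μ` is REFLECTION POSITIVE for the configuration map `Θ` and the edge set `S` (the closed half
of the mirror): `0 ≤ ∫ (F(ΘU))‾ F(U) dμ` (real and non-negative, `Complex.partialOrder`) for every
bounded measurable `F : LGConfig d G → ℂ` depending only on the links in `S` — the shape of the
tree's torus statement `wilsonExpectation_reflectionPositive`. [shape] A parametric definition of a
proposition — NOT a fact. [folklore] -/
def IsReflectionPositiveFor (Θ : LGConfig d G → LGConfig d G) (S : Set (ZdEdge d))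
    (μ : Measure (LGConfig d G)) : Prop :=
  ∀ F : LGConfig d G → ℂ, Measurable F → (∃ C : ℝ, ∀ U, ‖F U‖ ≤ C) → DependsOn F S →
    0 ≤ ∫ U, (starRingEnd ℂ) (F (Θ U)) * F U ∂μ

variable [TopologicalSpace G] (ρ : G →* Matrix (Fin N) (Fin N) ℂ)

/-- `μ` obeys the ONE-LINK HAAR-SHIFT (Gibbs) IDENTITY of the Wilson action at coupling `β`: for
every link `e`, every `g ∈ G` and every continuous cylinder observable `f`,
`∫ f(U[e ↦ g·U_e]) dμ = ∫ f(U) · exp(-β (S_e(U[e ↦ g⁻¹·U_e]) - S_e(U))) dμ`, where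
`S_e = wilsonBoundaryAction ρ {e}` is the Wilson action of the plaquettes containing `e`. This is
the `ℤ^d` form of the torus theorem `haarShift_wilsonExpectation` (there with the full action, whose
change under `U_e ↦ g⁻¹U_e` equals that of `S_e`); it expresses that the conditional law of `U_e`
given the other links is Haar measure tilted by `exp(-β S_e)` (the one-link DLR equation, Georgii
2011 Def. 2.9), and its derivative along `g = exp(tX)` is the single-link Schwinger–Dyson identity
behind the loop equations. [shape] A parametric definition of a proposition — NOT a fact.
[folklore] -/
def IsHaarShiftState (β : ℝ) (μ : Measure (LGConfig d G)) : Prop :=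
  ∀ (e : ZdEdge d) (g : G) (f : LGConfig d G → ℝ) (S : Finset (ZdEdge d)),
    IsCylinder f S → Continuous f →
      ∫ U, f (Function.update U e (g * U e)) ∂μ =
        ∫ U, f U * Real.exp (-(β * (wilsonBoundaryAction ρ {e} (Function.update U e (g⁻¹ * U e)) -
          wilsonBoundaryAction ρ {e} U))) ∂μ

end Axioms

/-! ## Class-B states -/

section ClassB

variable [Group G] [MeasurableSpace G] [TopologicalSpace G] (ρ : G →* Matrix (Fin N) (Fin N) ℂ)

variable (d) in
/-- **Class-B state** of `d`-dimensional lattice `G`-gauge theory (representation `ρ`, Wilson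
action, coupling `β`): a probability measure `μ` on the configurations `LGConfig d G` of the
INFINITE lattice `ℤ^d` which is
* invariant under lattice translations (`IsZdTranslationInvariant`), axis permutations
  (`configPerm`) and axis reflections (`configSiteReflect`) — i.e. under `ℤ^d ⋊ B_d`;
* a one-link Gibbs state of the Wilson action (`IsHaarShiftState ρ β`);
* reflection positive for the three mirror families of the lattice bootstrap: sites `x_i = 0`,
  links `x_i = ½`, diagonals `x_i = x_j` (Kazakov–Zheng arXiv:2203.11360 §3.1, arXiv:2404.16925 §3.2).
These are exactly the properties a loop-equation SDP with Gram + `R_site` + `R_link` + `R_diag`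
blocks consumes, so a certificate for such an SDP proves `a ≤ ∫ u_P dω.μ ≤ b` for every
`ω : ClassBState ρ β` ("Class B" of SCOPING.md A18). Whether the physically constructed states
belong to this class is `ThermodynamicLimitIsClassB` (OPEN in general) — it is deliberately NOT
a field of this structure. Nor is INHABITATION at a given `β` asserted: at `β = 0` the product
Haar measure qualifies, and in the Osterwalder–Seiler strong-coupling regime the unique Gibbs state
does; at other couplings the existence of a state with all three RP families AND translation
invariance is not established in this file (periodic volumes lose diagonal RP, free boxes lose
translation invariance). -/
structure ClassBState (β : ℝ) where
  /-- the state, a measure on `ℤ^d` gauge configurations -/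
  μ : Measure (LGConfig d G)
  /-- it is a probability measure -/
  isProbabilityMeasure : IsProbabilityMeasure μ
  /-- invariance under lattice translations -/
  translationInvariant : IsZdTranslationInvariant μ
  /-- invariance under permutations of the axes -/
  permInvariant : ∀ σ : Equiv.Perm (Fin d), MeasurePreserving (configPerm σ) μ μ
  /-- invariance under the axis reflections `x_i ↦ -x_i` -/
  reflectInvariant : ∀ i : Fin d, MeasurePreserving (configSiteReflect i) μ μ
  /-- the one-link Gibbs (Haar-shift) identity of the Wilson action at coupling `β` -/
  haarShift : IsHaarShiftState ρ β μ
  /-- reflection positivity in the site hyperplanes `x_i = 0` -/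
  siteRP : ∀ i : Fin d, IsReflectionPositiveFor (configSiteReflect i) (siteHalfEdges i) μ
  /-- reflection positivity in the link hyperplanes `x_i = ½` -/
  linkRP : ∀ i : Fin d, IsReflectionPositiveFor (configLinkReflect i) (linkHalfEdges i) μ
  /-- reflection positivity in the diagonal hyperplanes `x_i = x_j` -/
  diagRP : ∀ i j : Fin d, i ≠ j → IsReflectionPositiveFor (configDiagSwapZd i j) (diagHalfEdges i j) μ

variable [IsTopologicalGroup G] [CompactSpace G] [BorelSpace G]

variable (d) in
/-- **OPEN (identification of Class B with thermodynamic limits); a `Prop`, never asserted.**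
Every infinite-volume limit point of the torus Wilson states at coupling `β`
(`infiniteVolumeLimitPoints ρ β`, limits along tori `(ℤ/L)^d`, `L → ∞`) is (the measure of) a
Class-B state. Known where the infinite-volume state is unique — the Osterwalder–Seiler
strong-coupling regime (Ann. Phys. 110 (1978) §4; then torus and free-box limits agree and the
free-box states carry diagonal RP) — and OPEN otherwise: the torus states themselves violate
diagonal RP at every `β` (`not_diagonalReflectionPositive`), so nothing is inherited in the limit.
The cell never uses this as a hypothesis-free fact (SCOPING A18). [shape] A definition of a
proposition — NOT a fact. [folklore] -/
def ThermodynamicLimitIsClassB (β : ℝ) : Prop :=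
  ∀ μ ∈ infiniteVolumeLimitPoints (d := d) ρ β, ∃ ω : ClassBState d ρ β, ω.μ = μ

variable (d) in
/-- **OPEN; the load-bearing conjunct of `ThermodynamicLimitIsClassB`.** Every infinite-volume
limit point of the torus Wilson states is reflection positive in the diagonal hyperplanes
`x_i = x_j`. (The remaining Class-B properties of torus limit points — invariances, Haar-shift
identity, site- and link-RP — follow from torus theorems of the tree by weak limits; not carried
out here.) [shape] A definition of a proposition — NOT a fact. [folklore] -/
def TorusLimitPointsDiagonalRP (β : ℝ) : Prop :=
  ∀ μ ∈ infiniteVolumeLimitPoints (d := d) ρ β, ∀ i j : Fin d, i ≠ j →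
    IsReflectionPositiveFor (configDiagSwapZd (G := G) i j) (diagHalfEdges i j) μ

/-- The trivial direction of the identification: a Class-B limit point is diagonal-RP. -/
theorem torusLimitPointsDiagonalRP_of_thermodynamicLimitIsClassB {β : ℝ}
    (h : ThermodynamicLimitIsClassB d ρ β) : TorusLimitPointsDiagonalRP d ρ β := by
  intro μ hμ i j hij
  obtain ⟨ω, rfl⟩ := h μ hμ
  exact ω.diagRP i j hij

end ClassB

/-! ## From the axioms to SDP blocks -/

section Blocks

variable [MeasurableSpace G]

/-- Bilinear expansion under the integral: for bounded measurable families `A_a, B_b` and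
coefficients `c ∈ ℂ^n`, `Σ_{a,b} c̄_a c_b ∫ Ā_a B_b dμ = ∫ (Σ_a c_a A_a)‾ (Σ_b c_b B_b) dμ`
(finite measure). [folklore] -/
theorem sum_sum_conj_mul_integral_eq (μ : Measure (LGConfig d G)) [IsFiniteMeasure μ] {n : ℕ}
    (A B : Fin n → LGConfig d G → ℂ) (hA : ∀ a, Measurable (A a)) (hB : ∀ b, Measurable (B b))
    (hAb : ∀ a, ∃ C : ℝ, ∀ U, ‖A a U‖ ≤ C) (hBb : ∀ b, ∃ C : ℝ, ∀ U, ‖B b U‖ ≤ C) (c : Fin n → ℂ) :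
    ∑ a, ∑ b, (starRingEnd ℂ) (c a) * c b * ∫ U, (starRingEnd ℂ) (A a U) * B b U ∂μ =
      ∫ U, (starRingEnd ℂ) (∑ a, c a * A a U) * (∑ b, c b * B b U) ∂μ := by
  have hint : ∀ a b, Integrable (fun U => (starRingEnd ℂ) (A a U) * B b U) μ := fun a b => by
    obtain ⟨Ca, hCa⟩ := hAb a
    obtain ⟨Cb, hCb⟩ := hBb b
    refine Integrable.of_bound ((Complex.continuous_conj.measurable.comp (hA a)).mul
      (hB b)).aestronglyMeasurable (Ca * Cb) (ae_of_all _ fun U => ?_)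
    rw [norm_mul, RCLike.norm_conj]
    exact mul_le_mul (hCa U) (hCb U) (norm_nonneg _) ((norm_nonneg _).trans (hCa U))
  have h1 : ∀ U, (starRingEnd ℂ) (∑ a, c a * A a U) * (∑ b, c b * B b U) =
      ∑ a, ∑ b, (starRingEnd ℂ) (c a) * c b * ((starRingEnd ℂ) (A a U) * B b U) := fun U => by
    rw [map_sum, Finset.sum_mul]
    refine Finset.sum_congr rfl fun a _ => ?_
    rw [Finset.mul_sum]
    refine Finset.sum_congr rfl fun b _ => ?_
    rw [map_mul]
    ring
  simp_rw [h1]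
  rw [integral_finsetSum _ fun a _ => integrable_finsetSum _ fun b _ => (hint a b).const_mul _]
  refine Finset.sum_congr rfl fun a _ => ?_
  rw [integral_finsetSum _ fun b _ => (hint a b).const_mul _]
  exact Finset.sum_congr rfl fun b _ => (integral_const_mul _ _).symm

/-- `∫ s̄ s dμ ≥ 0` in the order of `ℂ` (real and non-negative). [folklore] -/
theorem integral_conj_mul_self_nonneg (μ : Measure (LGConfig d G)) (s : LGConfig d G → ℂ) :
    0 ≤ ∫ U, (starRingEnd ℂ) (s U) * s U ∂μ := by
  have h2 : (fun U => (starRingEnd ℂ) (s U) * s U) = fun U => ((Complex.normSq (s U) : ℝ) : ℂ) :=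
    funext fun U => by rw [Complex.normSq_eq_conj_mul_self]
  rw [h2, integral_complex_ofReal]
  exact Complex.zero_le_real.2 (integral_nonneg fun U => Complex.normSq_nonneg _)

/-- **Gram blocks are PSD for every finite measure**: for bounded measurable `F_1, …, F_n` and
`c ∈ ℂ^n`, `0 ≤ Σ_{a,b} c̄_a c_b ∫ F̄_a F_b dμ` (`= ∫ |Σ_b c_b F_b|² dμ`): the Hilbert-space
positivity blocks of the bootstrap need no axiom. [folklore] -/
theorem gram_sum_mul_conj_nonneg (μ : Measure (LGConfig d G)) [IsFiniteMeasure μ] {n : ℕ}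
    (F : Fin n → LGConfig d G → ℂ) (hF : ∀ a, Measurable (F a)) (hFb : ∀ a, ∃ C : ℝ, ∀ U, ‖F a U‖ ≤ C)
    (c : Fin n → ℂ) :
    0 ≤ ∑ a, ∑ b, (starRingEnd ℂ) (c a) * c b * ∫ U, (starRingEnd ℂ) (F a U) * F b U ∂μ := by
  rw [sum_sum_conj_mul_integral_eq μ F F hF hF hFb hFb c]
  exact integral_conj_mul_self_nonneg μ _

/-- **An RP axiom yields PSD RP blocks**: if `μ` is reflection positive for `(Θ, S)`, then for
bounded measurable `F_1, …, F_n` supported in `S` and `c ∈ ℂ^n`,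
`0 ≤ Σ_{a,b} c̄_a c_b ∫ (F_a∘Θ)‾ F_b dμ` — apply the axiom to `F = Σ_b c_b F_b`. This is the step
that turns the `siteRP` / `linkRP` / `diagRP` fields of a `ClassBState` into the `R_site` /
`R_link` / `R_diag` blocks of a loop-equation SDP. [folklore] -/
theorem IsReflectionPositiveFor.sum_mul_conj_nonneg {Θ : LGConfig d G → LGConfig d G}
    (hΘ : Measurable Θ) {S : Set (ZdEdge d)} {μ : Measure (LGConfig d G)} [IsFiniteMeasure μ]
    (hμ : IsReflectionPositiveFor Θ S μ) {n : ℕ} (F : Fin n → LGConfig d G → ℂ)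
    (hF : ∀ a, Measurable (F a)) (hFb : ∀ a, ∃ C : ℝ, ∀ U, ‖F a U‖ ≤ C)
    (hFS : ∀ a, DependsOn (F a) S) (c : Fin n → ℂ) :
    0 ≤ ∑ a, ∑ b, (starRingEnd ℂ) (c a) * c b *
      ∫ U, (starRingEnd ℂ) (F a (Θ U)) * F b U ∂μ := by
  rw [sum_sum_conj_mul_integral_eq μ (fun a U => F a (Θ U)) F (fun a => (hF a).comp hΘ) hF
    (fun a => (hFb a).imp fun C hC U => hC (Θ U)) hFb c]
  refine hμ (fun U => ∑ b, c b * F b U) (Finset.measurable_sum _ fun b _ => (hF b).const_mul _)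
    ?_ ?_
  · choose C hC using hFb
    refine ⟨∑ b, ‖c b‖ * C b, fun U => (norm_sum_le _ _).trans (Finset.sum_le_sum fun b _ => ?_)⟩
    rw [norm_mul]
    exact mul_le_mul_of_nonneg_left (hC b U) (norm_nonneg _)
  · intro U V hUV
    exact Finset.sum_congr rfl fun b _ => by rw [hFS b hUV]

end Blocks

end Summit.QuantumFields.GaugeBoot

end
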